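import Mathlib
import Literature.Algebra.EuclideanLattices.KhotParameters
import Literature.Computability.MetaComplexity.UHSParameters
import HarnessLib

/-!
# R10 (`positive-circuit-chart`) — F7a: ARITHMETIC of the confined count
`2^{m + L} · pencilBd s (2m((m+2)^C+1)) ≤ 2^{a m} (t+2)^b` for `s ≤ 2mt`, `L ≤ Cm`, with `a = b = 32 (C+3)^2`
(`pencilBd s n = 2(s²+1)(log₂ n + 1) n^{2 log₂ n}`).  Pure arithmetic, no mathematics of the rung.
R275 P3 scope: tool; nothing here closes 5906; VP ≠ VNP is NOT proved.
-/

set_option linter.dupNamespace false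
set_option linter.unusedSectionVars false

namespace Summit.ValiantsHypothesis.ValiantsHypothesis.Theorems.NewtonUnitEquations.TwoProducts.PermutationType
namespace R10

/-- `(log₂ x + 1)^2 ≤ 4x` for `x ≥ 1`. [folklore] -/
theorem sq_log_succ_le (x : ℕ) (hx : 1 ≤ x) : (Nat.log 2 x + 1) ^ 2 ≤ 4 * x := by
  have h := Literature.Computability.MetaComplexity.UHSParam.sq_succ_le (Nat.log 2 x)
  have h2 : 2 ^ Nat.log 2 x ≤ x := Nat.pow_log_le_self 2 (by omega)
  exact h.trans (Nat.mul_le_mul_left 4 h2)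

/-- Log of a power: `log₂ (x^K) + 1 ≤ K (log₂ x + 1)` for `x ≥ 1`, `K ≥ 1`. [folklore] -/
theorem log_pow_succ_le (x K : ℕ) (hx : 1 ≤ x) (hK : 1 ≤ K) : Nat.log 2 (x ^ K) + 1 ≤ K * (Nat.log 2 x + 1) := by
  have hlt : x < 2 ^ (Nat.log 2 x + 1) := Nat.lt_pow_succ_log_self (by norm_num) x
  have hpow : x ^ K < 2 ^ (K * (Nat.log 2 x + 1)) := by
    rw [pow_mul']
    exact Nat.pow_lt_pow_left hlt (by omega)
  have := Nat.log_lt_of_lt_pow (by positivity) hpow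
  omega

/-- Monotone log bound: `n ≤ x^K` gives `log₂ n + 1 ≤ K (log₂ x + 1)`. [folklore] -/
theorem log_succ_le_of_le_pow (n x K : ℕ) (hx : 1 ≤ x) (hK : 1 ≤ K) (hn : n ≤ x ^ K) :
    Nat.log 2 n + 1 ≤ K * (Nat.log 2 x + 1) :=
  (Nat.add_le_add_right (Nat.log_mono_right hn) 1).trans (log_pow_succ_le x K hx hK)

/-- The shift-rank parameter is a power of `m + 2`: `2m((m+2)^C + 1) ≤ (m+2)^{C+3}`. [folklore] -/
theorem n_le_pow (m C : ℕ) : 2 * m * ((m + 2) ^ C + 1) ≤ (m + 2) ^ (C + 3) := by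
  have h1 : (m + 2) ^ C + 1 ≤ 2 * (m + 2) ^ C := by
    have : 1 ≤ (m + 2) ^ C := Nat.one_le_pow _ _ (by omega); omega
  have h2 : 2 * m ≤ (m + 2) ^ 2 := by nlinarith
  calc 2 * m * ((m + 2) ^ C + 1) ≤ (m + 2) ^ 2 * (2 * (m + 2) ^ C) := Nat.mul_le_mul h2 h1
    _ = 2 * (m + 2) ^ (C + 2) := by ring
    _ ≤ (m + 2) * (m + 2) ^ (C + 2) := Nat.mul_le_mul_right _ (by omega)
    _ = (m + 2) ^ (C + 3) := by ring

/-- The pencil-count core: `(log₂ n + 1) · n^{2 log₂ n} ≤ 2^{10 K² (m+2)}` for `n ≤ (m+2)^K`, `K ≥ 1`. [folklore] -/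
theorem core_le (n m K : ℕ) (hK : 1 ≤ K) (hn : n ≤ (m + 2) ^ K) :
    (Nat.log 2 n + 1) * n ^ (2 * Nat.log 2 n) ≤ 2 ^ (10 * K ^ 2 * (m + 2)) := by
  set ℓ := Nat.log 2 (m + 2) + 1 with hℓ
  have hL : Nat.log 2 n + 1 ≤ K * ℓ := log_succ_le_of_le_pow n (m + 2) K (by omega) hK hn
  have hℓsq : ℓ ^ 2 ≤ 4 * (m + 2) := sq_log_succ_le (m + 2) (by omega)
  have hℓle : ℓ ≤ m + 2 := by
    have := Nat.log_lt_self 2 (show m + 2 ≠ 0 by omega) |>.le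
    have h2 : Nat.log 2 (m + 2) < m + 2 := Nat.log_lt_self 2 (by omega)
    omega
  -- n^{2 log n} ≤ (2^{Kℓ})^{2Kℓ}
  have h1 : n ^ (2 * Nat.log 2 n) ≤ (2 ^ (K * ℓ)) ^ (2 * (K * ℓ)) := by
    calc n ^ (2 * Nat.log 2 n) ≤ (2 ^ (Nat.log 2 n + 1)) ^ (2 * Nat.log 2 n) :=
          Nat.pow_le_pow_left (Literature.Algebra.EuclideanLattices.Khot.le_two_pow_log_succ n) _
      _ ≤ (2 ^ (K * ℓ)) ^ (2 * Nat.log 2 n) := Nat.pow_le_pow_left (Nat.pow_le_pow_right (by norm_num) hL) _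
      _ ≤ (2 ^ (K * ℓ)) ^ (2 * (K * ℓ)) := Nat.pow_le_pow_right (by positivity) (by omega)
  have h2 : (2 ^ (K * ℓ)) ^ (2 * (K * ℓ)) = 2 ^ (2 * (K * ℓ) ^ 2) := by rw [← pow_mul]; ring_nf
  have h3 : 2 * (K * ℓ) ^ 2 ≤ 8 * K ^ 2 * (m + 2) := by
    have : (K * ℓ) ^ 2 = K ^ 2 * ℓ ^ 2 := by ring
    rw [this]; nlinarith
  have h4 : Nat.log 2 n + 1 ≤ 2 ^ (K * ℓ) := hL.trans (Nat.lt_two_pow_self).le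
  have h5 : K * ℓ ≤ K ^ 2 * (m + 2) := by
    calc K * ℓ ≤ K * (m + 2) := Nat.mul_le_mul_left K hℓle
      _ ≤ K ^ 2 * (m + 2) := Nat.mul_le_mul_right _ (by nlinarith)
  calc (Nat.log 2 n + 1) * n ^ (2 * Nat.log 2 n) ≤ 2 ^ (K * ℓ) * 2 ^ (2 * (K * ℓ) ^ 2) := by
        rw [← h2]; exact Nat.mul_le_mul h4 h1
    _ = 2 ^ (K * ℓ + 2 * (K * ℓ) ^ 2) := by rw [← pow_add]
    _ ≤ 2 ^ (10 * K ^ 2 * (m + 2)) := Nat.pow_le_pow_right (by norm_num) (by nlinarith)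

/-- The free-dimension factor: `2(s²+1) ≤ 2^{2m} (t+2)^6` for `s ≤ 2mt`. [folklore] -/
theorem sfac_le (s m t : ℕ) (hs : s ≤ 2 * m * t) : 2 * (s * s + 1) ≤ 2 ^ (2 * m) * (t + 2) ^ 6 := by
  have h1 : s * s ≤ (2 * m * t) * (2 * m * t) := Nat.mul_le_mul hs hs
  have hm : m * m ≤ 2 ^ (2 * m) := by
    have : m ≤ 2 ^ m := Nat.lt_two_pow_self.le
    calc m * m ≤ 2 ^ m * 2 ^ m := Nat.mul_le_mul this this
      _ = 2 ^ (2 * m) := by rw [← pow_add]; ring_nf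
  have ht : t * t ≤ (t + 2) ^ 2 := by nlinarith
  have h16 : 16 ≤ (t + 2) ^ 4 := by
    have : 2 ≤ t + 2 := by omega
    calc 16 = 2 ^ 4 := by norm_num
      _ ≤ (t + 2) ^ 4 := Nat.pow_le_pow_left this 4
  have hp : 1 ≤ 2 ^ (2 * m) := Nat.one_le_two_pow
  have hq : 1 ≤ (t + 2) ^ 2 := Nat.one_le_pow _ _ (by omega)
  calc 2 * (s * s + 1) ≤ 2 * ((2 * m * t) * (2 * m * t) + 1) := by omega
    _ = 8 * (m * m) * (t * t) + 2 := by ring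
    _ ≤ 8 * 2 ^ (2 * m) * (t + 2) ^ 2 + 2 * (2 ^ (2 * m) * (t + 2) ^ 2) := by
        have := Nat.mul_le_mul (Nat.mul_le_mul_left 8 hm) ht
        nlinarith
    _ = 10 * (2 ^ (2 * m) * (t + 2) ^ 2) := by ring
    _ ≤ (t + 2) ^ 4 * (2 ^ (2 * m) * (t + 2) ^ 2) := Nat.mul_le_mul_right _ (by omega)
    _ = 2 ^ (2 * m) * (t + 2) ^ 6 := by ring

/-- **THE ARITHMETIC OF THE CONFINED COUNT**: with `a = b = 32 (C+3)^2`,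
`2^{m+L} · 2(s²+1)(log₂ n+1) n^{2 log₂ n} ≤ 2^{a m}(t+2)^{b}` for `s ≤ 2mt`, `L ≤ Cm`, `n = 2m((m+2)^C+1)`. [folklore] -/
theorem arith_R10 (C m s t L : ℕ) (hs : s ≤ 2 * m * t) (hL : L ≤ C * m) :
    2 ^ (m + L) * (2 * (s * s + 1) * ((Nat.log 2 (2 * m * ((m + 2) ^ C + 1)) + 1) *
      (2 * m * ((m + 2) ^ C + 1)) ^ (2 * Nat.log 2 (2 * m * ((m + 2) ^ C + 1))))) ≤
      2 ^ (32 * (C + 3) ^ 2 * m) * (t + 2) ^ (32 * (C + 3) ^ 2) := by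
  set K := C + 3 with hK
  set n := 2 * m * ((m + 2) ^ C + 1) with hn
  have hcore := core_le n m K (by omega) (by rw [hn, hK]; exact n_le_pow m C)
  have hsf := sfac_le s m t hs
  have h2 : 2 ≤ t + 2 := by omega
  -- 2^{10K²(m+2)} = 2^{10K² m} · 2^{20 K²} ≤ 2^{10K² m} (t+2)^{20K²}
  have hsplit : 2 ^ (10 * K ^ 2 * (m + 2)) ≤ 2 ^ (10 * K ^ 2 * m) * (t + 2) ^ (20 * K ^ 2) := by
    rw [show 10 * K ^ 2 * (m + 2) = 10 * K ^ 2 * m + 20 * K ^ 2 by ring, pow_add]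
    exact Nat.mul_le_mul_left _ (Nat.pow_le_pow_left h2 _)
  have hCK : C + 3 ≤ K ^ 2 := by rw [hK]; exact Nat.le_self_pow (by norm_num) (C + 3)
  have hKm : m + L + 2 * m + 10 * K ^ 2 * m ≤ 32 * K ^ 2 * m := by
    have h1 : (C + 3) * m ≤ K ^ 2 * m := Nat.mul_le_mul_right m hCK
    have h2 : m + L + 2 * m ≤ (C + 3) * m := by
      have : (C + 3) * m = C * m + 3 * m := by ring
      rw [this]; linarith
    have h3 : 10 * K ^ 2 * m = 10 * (K ^ 2 * m) := by ring
    have h4 : 32 * K ^ 2 * m = 32 * (K ^ 2 * m) := by ring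
    rw [h3, h4]
    linarith
  have hKt : 6 + 20 * K ^ 2 ≤ 32 * K ^ 2 := by
    have : 9 ≤ K ^ 2 := by rw [hK]; nlinarith
    omega
  calc 2 ^ (m + L) * (2 * (s * s + 1) * ((Nat.log 2 n + 1) * n ^ (2 * Nat.log 2 n)))
      ≤ 2 ^ (m + L) * ((2 ^ (2 * m) * (t + 2) ^ 6) * (2 ^ (10 * K ^ 2 * m) * (t + 2) ^ (20 * K ^ 2))) :=
        Nat.mul_le_mul_left _ (Nat.mul_le_mul hsf (hcore.trans hsplit))
    _ = 2 ^ (m + L + 2 * m + 10 * K ^ 2 * m) * (t + 2) ^ (6 + 20 * K ^ 2) := by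
        set A := (2 : ℕ) with hA
        set B := t + 2 with hB
        clear_value A B
        rw [pow_add, pow_add, pow_add, pow_add]; ring
    _ ≤ 2 ^ (32 * K ^ 2 * m) * (t + 2) ^ (32 * K ^ 2) :=
        Nat.mul_le_mul (Nat.pow_le_pow_right (by norm_num) hKm) (Nat.pow_le_pow_right (by omega) hKt)

end R10
end Summit.ValiantsHypothesis.ValiantsHypothesis.Theorems.NewtonUnitEquations.TwoProducts.PermutationType
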